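import Summits.CriticalPhenomena.PercolationContinuityZ3.Theorems.PercNearOneGluingNoHeavyLowerTailSahiCoveringTripleRows
import Literature.Combinatorics.Sahi2008.GeneratingFunction
import HarnessLib

/-!
# `NoHeavyLowerTail` (crux stmt-CriticalPhenomena-4575), master-family line P2: Sahi's Conjecture 4 (the power-series form) holds on
# the pattern algebra of every proved E3GRP row

Support file (seat `prim-masterthm-p2`, gen 2; `--supports stmt-CriticalPhenomena-4575`); no named fact, no sorry; corollaries only.

Sahi's Conjecture 4 [Sahi2008, p. 212; LiebSahi2021, Conj. 1.2]: for nonnegative monotone `f₁, f₂, …` on a finite weighted poset, every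
coefficient of `1 − ∏_x (1 − Σ_i f_i(x) tⁱ)^{μ(x)}` is `≥ 0`.  It is equivalent, weight by weight, to Sahi positivity of every order
(tree `forall_sahiPositive_iff_sahiSeries` = [LiebSahi2021, Thm. 4.4]).  Combined with `…SahiCoveringTripleRows`:
* `coeff_sahiSeries_hybrid_nonneg` — Conjecture 4 holds for the pattern weight of the hybrid/group three-point family
  `({P₁ ≁ c}, {P₁ ≁ P₃'}, {c ≁ P₃})`, `P₃ ⊆ P₃'`, on every finite weighted graph (unconditional);
* `coeff_sahiSeries_row_dec_nonneg` — and for the four decreasing five-terminal E3GRP rows `r0–r3` (unconditional);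
* `coeff_sahiSeries_row_nonneg_of_generators` — for all nine rows from `TIncRow`, `GammaRow`, `AlphaRow`.
So on these algebras Sahi's programme [Sahi2008, Thm. 1 for `𝒞[X]`; Conj. 4 for `ℐ[X]`] is complete: the series is coefficientwise
nonnegative for every admissible input, although none of the events is a cumulation (memo SAHI-ROUTE.md §3 O1, §4.7–4.8).
-/

noncomputable section

namespace Summit.CriticalPhenomena.PercolationContinuityZ3.Theorems.SahiDeltaSystem

open Finset Function MeasureTheory PowerSeries Literature.Combinatorics.Sahi2008
open Literature.Probability.Percolation
open P7

section Hybrid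

variable {V : Type*} [Fintype V]

/-- **Sahi's Conjecture 4 on the hybrid three-point algebra** (every finite weighted graph, `P₃ ⊆ P₃'`): every coefficient of
Sahi's series of the pattern weight is nonnegative, for every sequence of nonnegative monotone `f_i : P7 → ℝ`. [this work] -/
theorem coeff_sahiSeries_hybrid_nonneg (w : Sym2 V → unitInterval) (c : V) (P₁ P₃ P₃' : Finset V) (hP : P₃ ⊆ P₃')
    (f : ℕ → P7 → ℝ) (hf0 : ∀ i x, 0 ≤ f i x) (hfm : ∀ i, Monotone (f i)) (M : ℕ) :
    0 ≤ coeff M (sahiSeries (pushWeight (bernoulliWeight w) (pat {ω : BondConfig V | ∀ u ∈ P₁, ω ∉ openConn c u}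
      {ω | ∀ v ∈ P₃', ∀ u ∈ P₁, ω ∉ openConn v u} {ω | ∀ v ∈ P₃, ω ∉ openConn c v})) f) :=
  (forall_sahiPositive_iff_sahiSeries _ (sum_pushWeight_pat w _ _ _)).1 (sahiPositive_hybrid w c P₁ P₃ P₃' hP) f hf0 hfm M

end Hybrid

section Rows

open CovTransferCert E3GroupSepCert

variable {n : ℕ}

/-- **Sahi's Conjecture 4 on the algebra of each decreasing five-terminal row** `r0–r3` (every `n`, weight, tuple), unconditionally.
[this work] -/
theorem coeff_sahiSeries_row_dec_nonneg (i : Fin 9) (hi : i.val ≤ 3) (w : Sym2 (Fin n) → unitInterval) (t : Tup n)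
    (f : ℕ → P7 → ℝ) (hf0 : ∀ j x, 0 ≤ f j x) (hfm : ∀ j, Monotone (f j)) (M : ℕ) :
    0 ≤ coeff M (sahiSeries (pushWeight (bernoulliWeight w) (patRow i t)) f) :=
  (forall_sahiPositive_iff_sahiSeries _ (by rw [sum_pushWeight, sum_bernoulliWeight])).1 (sahiPositive_row_dec i hi w t)
    f hf0 hfm M

/-- Sahi's Conjecture 4 on the algebras of all nine rows, from the three generators `TIncRow`, `GammaRow`, `AlphaRow`. [this work] -/
theorem coeff_sahiSeries_row_nonneg_of_generators (hT : TIncRow) (hG : GammaRow) (hA : AlphaRow) (i : Fin 9)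
    (w : Sym2 (Fin n) → unitInterval) (t : Tup n) (f : ℕ → P7 → ℝ) (hf0 : ∀ j x, 0 ≤ f j x) (hfm : ∀ j, Monotone (f j))
    (M : ℕ) : 0 ≤ coeff M (sahiSeries (pushWeight (bernoulliWeight w) (patRow i t)) f) :=
  (forall_sahiPositive_iff_sahiSeries _ (by rw [sum_pushWeight, sum_bernoulliWeight])).1
    (sahiPositive_row_of_generators hT hG hA i w t) f hf0 hfm M

end Rows

end Summit.CriticalPhenomena.PercolationContinuityZ3.Theorems.SahiDeltaSystem

end
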